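import Literature.Probability.Process.ConformalClock
import HarnessLib

/-!
# Inverting the conformal clock: the time change `α_u = inf{t : σ_t ≥ u} ∧ ρ`

Third file on P. Lévy's conformal invariance of planar Brownian motion (Lawler (2005),
Thm. 2.2: "`f(B_t)`, … is a time change of a Brownian motion", with the time change
`σ_t = ∫₀ᵗ |f'(B_s)|² ds`; Le Gall (2016), proof of Thm. 5.13: `τ_r = inf{s : ⟨M⟩ₛ > r}`). For
the planar Brownian motion `X = x₀ + W` stopped at the exit time `ρ` of `U` and the clock
`σ = confClock` (`ConformalMartingaleClock`, `ConformalClock`) we define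

* `clockLevel u` — the first passage time of `σ` at level `u` (Mathlib `hittingAfter`, in
  `WithTop ℝ≥0`), and **`clockInv u = clockLevel u ∧ ρ`**, the inverse clock `α_u`;
* `isStoppingTime_clockInv` — `α_u` is a stopping time of the natural filtration (the clock is
  adapted with continuous paths; `Process.isStoppingTime_hittingAfter_of_continuous`);
  `clockInv_mono`, `clockInv_le_hitTime`;

and, on the almost sure event `{ρ = T < ∞}`,

* `confClock_clockInv` — **`σ_{α_u} = u ∧ S`**, `S = σ_T` the total clock;
* `clockInv_confClock` — **`α_{σ_t} = t`** for `t ≤ T` (the clock is strictly increasing,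
  `confClock_sub_ge`), `clockInv_lt_iff` — `α_u < T ↔ u < S`;
* `continuous_clockInvFun` — **`u ↦ α_u` is continuous** (it is the inverse homeomorphism of
  `σ : [0, T] → [0, S]` composed with `u ↦ u ∧ S`).

## References

* G. F. Lawler, *Conformally Invariant Processes in the Plane*, AMS (2005), Thm. 2.2.
* J.-F. Le Gall, *Brownian Motion, Martingales, and Stochastic Calculus* (2016), Prop. 5.14,
  Thm. 5.13, Thm. 7.19.
-/

noncomputable section

open MeasureTheory Filter Topology Set Complex
open scoped NNReal ENNReal BigOperators ComplexConjugate

namespace Literature.Probability.Process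

variable {Ω : Type*} {mΩ : MeasurableSpace Ω} {P : Measure Ω} {W : ℝ≥0 → Ω → (Fin 2 → ℝ)}

namespace IsBrownianVec

variable {x₀ : Fin 2 → ℝ} {U : Set (Fin 2 → ℝ)} {D : Set ℂ} {f : ℂ → ℂ}

/-! ### The inverse clock -/

/-- The inverse clock is monotone in the level. [folklore] -/
theorem clockInv_mono (ω : Ω) {u v : ℝ≥0} (h : u ≤ v) : clockInv x₀ W f U u ω ≤ clockInv x₀ W f U v ω := by
  refine min_le_min_right _ ?_
  have := hittingAfter_anti (confClock x₀ W f U) (0 : ℝ≥0) (Ici_subset_Ici.2 (NNReal.coe_le_coe.2 h))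
  exact this ω

/-- As functions: `clockInv u ≤ clockInv v` for `u ≤ v`. [folklore] -/
theorem clockInv_mono' {u v : ℝ≥0} (h : u ≤ v) : clockInv x₀ W f U u ≤ clockInv x₀ W f U v :=
  fun ω ↦ clockInv_mono ω h

/-- **The inverse clock is a stopping time** of the natural filtration. [cite: Legall2016, Prop. 5.14] -/
theorem isStoppingTime_clockInv (hW : IsBrownianVec W P) (hD : IsOpen D) (hf : DifferentiableOn ℂ f D)
    (hU : IsOpen U) (hUD : closure U ⊆ toC ⁻¹' D) (hx₀ : x₀ ∈ U) (u : ℝ≥0) :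
    IsStoppingTime hW.natFiltration (clockInv x₀ W f U u) :=
  (isStoppingTime_hittingAfter_of_continuous (hW.adapted_confClock hD hf hU hUD hx₀)
    (fun ω ↦ hW.continuous_confClock hD hf hU hUD hx₀ ω) isClosed_Ici).min
    (hW.isStoppingTime_hitTime hU.isClosed_compl)

/-! ### Values of the clock at the inverse clock (finite exit time) -/

section Finite

variable {ω : Ω} {T : ℝ≥0}

/-- With a finite exit time, the inverse clock is finite. [folklore] -/
theorem clockInv_ne_top (hρ : hitTime x₀ W Uᶜ ω = T) (u : ℝ≥0) : clockInv x₀ W f U u ω ≠ ⊤ :=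
  ne_top_of_le_ne_top (by rw [hρ]; exact WithTop.coe_ne_top) (clockInv_le_hitTime u ω)

/-- With a finite exit time `T`, the inverse clock is at most `T`. [folklore] -/
theorem untopA_clockInv_le (hρ : hitTime x₀ W Uᶜ ω = T) (u : ℝ≥0) : (clockInv x₀ W f U u ω).untopA ≤ T := by
  have h := clockInv_le_hitTime (x₀ := x₀) (W := W) (f := f) (U := U) u ω
  rw [hρ] at h
  obtain ⟨a, ha⟩ := WithTop.ne_top_iff_exists.1 (clockInv_ne_top (f := f) hρ u)
  rw [← ha] at h ⊢
  exact WithTop.coe_le_coe.1 h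

/-- The clock never exceeds the total clock `S = σ_T`. [folklore] -/
theorem confClock_le_total (hW : IsBrownianVec W P) (hD : IsOpen D) (hf : DifferentiableOn ℂ f D)
    (hU : IsOpen U) (hUD : closure U ⊆ toC ⁻¹' D) (hx₀ : x₀ ∈ U) (hρ : hitTime x₀ W Uᶜ ω = T) (t : ℝ≥0) :
    confClock x₀ W f U t ω ≤ confClock x₀ W f U T ω := by
  rcases le_total t T with h | h
  · exact hW.confClock_mono hD hf hU hUD hx₀ ω h
  · rw [confClock_eq_of_le hρ h]

/-- **`σ_{α_u} = u ∧ S`** on `{ρ = T}`, `S = σ_T`. [cite: Legall2016, proof of Thm. 5.13] -/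
theorem confClock_clockInv (hW : IsBrownianVec W P) (hD : IsOpen D) (hf : DifferentiableOn ℂ f D)
    (hU : IsOpen U) (hUD : closure U ⊆ toC ⁻¹' D) (hx₀ : x₀ ∈ U) (hρ : hitTime x₀ W Uᶜ ω = T) (u : ℝ≥0) :
    confClock x₀ W f U (clockInv x₀ W f U u ω).untopA ω = min (u : ℝ) (confClock x₀ W f U T ω) := by
  have hcont := hW.continuous_confClock hD hf hU hUD hx₀ ω
  by_cases hu : (u : ℝ) ≤ confClock x₀ W f U T ω
  · -- the level is reached, at a time `a ≤ T` with `σ_a = u`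
    rw [min_eq_left hu]
    obtain ⟨t, ht, htu⟩ : ∃ t ∈ Icc (0 : ℝ≥0) T, confClock x₀ W f U t ω = u := by
      have hivt := intermediate_value_Icc (show (0 : ℝ≥0) ≤ T from bot_le) (hcont.continuousOn (s := Icc 0 T))
      rw [confClock_zero] at hivt
      exact hivt ⟨u.coe_nonneg, hu⟩
    have hmem : confClock x₀ W f U t ω ∈ Ici (u : ℝ) := by rw [htu]; exact self_mem_Ici
    have hlev : clockLevel x₀ W f U u ω ≤ t := hittingAfter_le_of_mem bot_le hmem
    have hne : clockLevel x₀ W f U u ω ≠ ⊤ := ne_top_of_le_ne_top WithTop.coe_ne_top hlev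
    obtain ⟨a, ha⟩ := WithTop.ne_top_iff_exists.1 hne
    have hat : a ≤ t := by rw [← ha] at hlev; exact WithTop.coe_le_coe.1 hlev
    have haT : a ≤ T := hat.trans ht.2
    have hinv : clockInv x₀ W f U u ω = a := by
      rw [clockInv, ← ha, hρ, ← WithTop.coe_min, min_eq_left haT]
    rw [hinv, untopA_coe]
    have h1 : confClock x₀ W f U a ω ∈ Ici (u : ℝ) :=
      mem_of_hittingAfter_zero_eq_coe isClosed_Ici hcont ha.symm
    have h2 : confClock x₀ W f U a ω ≤ u := htu ▸ hW.confClock_mono hD hf hU hUD hx₀ ω hat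
    exact le_antisymm h2 h1
  · -- the level is never reached
    rw [not_le] at hu
    rw [min_eq_right hu.le]
    have hlev : clockLevel x₀ W f U u ω = ⊤ :=
      hittingAfter_zero_apply_of_forall fun j hj ↦
        not_le.2 hu ((mem_Ici.1 hj).trans (hW.confClock_le_total hD hf hU hUD hx₀ hρ j))
    rw [clockInv, hlev, hρ, min_eq_right le_top, untopA_coe]

/-- `α_u < T ↔ u < S` (strictly increasing clock). [folklore] -/
theorem clockInv_lt_iff (hW : IsBrownianVec W P) (hD : IsOpen D) (hf : DifferentiableOn ℂ f D)
    (hU : IsOpen U) (hUD : closure U ⊆ toC ⁻¹' D) (hx₀ : x₀ ∈ U) {m : ℝ} (hm0 : 0 < m)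
    (hm : ∀ y ∈ closure U, m ≤ ‖deriv f (toC y)‖ ^ 2) (hρ : hitTime x₀ W Uᶜ ω = T) (u : ℝ≥0) :
    (clockInv x₀ W f U u ω).untopA < T ↔ (u : ℝ) < confClock x₀ W f U T ω := by
  have hval := hW.confClock_clockInv hD hf hU hUD hx₀ hρ u
  have hle := untopA_clockInv_le (f := f) hρ u
  constructor
  · intro hlt
    -- strictly below `T`, the clock is strictly below `S`
    have hgap := hW.confClock_sub_ge hD hf hU hUD hx₀ hm ω hlt.le
    rw [stopT_of_eq_coe hρ, stopT_of_eq_coe hρ, min_self, min_eq_left hle] at hgap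
    have hpos : 0 < m * ((T : ℝ) - (clockInv x₀ W f U u ω).untopA) :=
      mul_pos hm0 (sub_pos.2 (NNReal.coe_lt_coe.2 hlt))
    have : min (u : ℝ) (confClock x₀ W f U T ω) < confClock x₀ W f U T ω := by rw [← hval]; linarith
    by_contra h
    rw [not_lt] at h
    rw [min_eq_right h] at this
    exact lt_irrefl _ this
  · intro hlt
    rcases lt_or_eq_of_le hle with h | h
    · exact h
    · rw [h, min_eq_left hlt.le] at hval
      -- then `σ_T = u < σ_T`
      exact absurd hval (ne_of_gt hlt)

/-- **`α_{σ_t} = t` for `t ≤ T`** (strictly increasing clock). [cite: Legall2016, proof of Thm. 5.13] -/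
theorem clockInv_confClock (hW : IsBrownianVec W P) (hD : IsOpen D) (hf : DifferentiableOn ℂ f D)
    (hU : IsOpen U) (hUD : closure U ⊆ toC ⁻¹' D) (hx₀ : x₀ ∈ U) {m : ℝ} (hm0 : 0 < m)
    (hm : ∀ y ∈ closure U, m ≤ ‖deriv f (toC y)‖ ^ 2) (hρ : hitTime x₀ W Uᶜ ω = T) {t : ℝ≥0} (ht : t ≤ T) :
    (clockInv x₀ W f U (confClock x₀ W f U t ω).toNNReal ω).untopA = t := by
  set u : ℝ≥0 := (confClock x₀ W f U t ω).toNNReal with hu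
  have hu' : (u : ℝ) = confClock x₀ W f U t ω :=
    Real.coe_toNNReal _ (by have := hW.confClock_mono hD hf hU hUD hx₀ ω (show (0 : ℝ≥0) ≤ t from bot_le); rwa [confClock_zero] at this)
  have hval := hW.confClock_clockInv hD hf hU hUD hx₀ hρ u
  rw [hu', min_eq_left (hW.confClock_le_total hD hf hU hUD hx₀ hρ t)] at hval
  -- two times `≤ T` with the same clock value coincide
  set a := (clockInv x₀ W f U u ω).untopA with ha
  have haT : a ≤ T := untopA_clockInv_le hρ u
  by_contra hne
  rcases lt_or_gt_of_ne hne with h | h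
  · have hgap := hW.confClock_sub_ge hD hf hU hUD hx₀ hm ω h.le
    rw [stopT_of_eq_coe hρ, stopT_of_eq_coe hρ, min_eq_left ht, min_eq_left haT, hval, sub_self] at hgap
    have : 0 < m * ((t : ℝ) - a) := mul_pos hm0 (sub_pos.2 (NNReal.coe_lt_coe.2 h))
    linarith
  · have hgap := hW.confClock_sub_ge hD hf hU hUD hx₀ hm ω h.le
    rw [stopT_of_eq_coe hρ, stopT_of_eq_coe hρ, min_eq_left ht, min_eq_left haT, hval, sub_self] at hgap
    have : 0 < m * ((a : ℝ) - t) := mul_pos hm0 (sub_pos.2 (NNReal.coe_lt_coe.2 h))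
    linarith

/-! ### Continuity of the inverse clock -/

/-- **The clock restricted to `[0, T]` is a homeomorphism onto `[0, S]`** (continuous, strictly
increasing, onto by the intermediate value theorem). [folklore] -/
theorem exists_homeomorph_clock (hW : IsBrownianVec W P) (hD : IsOpen D) (hf : DifferentiableOn ℂ f D)
    (hU : IsOpen U) (hUD : closure U ⊆ toC ⁻¹' D) (hx₀ : x₀ ∈ U) {m : ℝ} (hm0 : 0 < m)
    (hm : ∀ y ∈ closure U, m ≤ ‖deriv f (toC y)‖ ^ 2) (hρ : hitTime x₀ W Uᶜ ω = T) :
    ∃ e : Icc (0 : ℝ≥0) T ≃ₜ Icc (0 : ℝ) (confClock x₀ W f U T ω),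
      ∀ t : Icc (0 : ℝ≥0) T, (e t : ℝ) = confClock x₀ W f U t ω := by
  have hcont := hW.continuous_confClock hD hf hU hUD hx₀ ω
  -- the restricted clock
  have hmaps : ∀ t : Icc (0 : ℝ≥0) T, confClock x₀ W f U t ω ∈ Icc (0 : ℝ) (confClock x₀ W f U T ω) := fun t ↦
    ⟨by have := hW.confClock_mono hD hf hU hUD hx₀ ω (show (0 : ℝ≥0) ≤ (t : ℝ≥0) from bot_le); rwa [confClock_zero] at this,
      hW.confClock_mono hD hf hU hUD hx₀ ω t.2.2⟩
  set g : Icc (0 : ℝ≥0) T → Icc (0 : ℝ) (confClock x₀ W f U T ω) := fun t ↦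
    ⟨confClock x₀ W f U t ω, hmaps t⟩ with hg
  have hgc : Continuous g := (hcont.comp continuous_subtype_val).subtype_mk _
  have hstrict : ∀ s t : Icc (0 : ℝ≥0) T, (s : ℝ≥0) < t → confClock x₀ W f U s ω < confClock x₀ W f U t ω := by
    intro s t hst
    have hgap := hW.confClock_sub_ge hD hf hU hUD hx₀ hm ω hst.le
    rw [stopT_of_eq_coe hρ, stopT_of_eq_coe hρ, min_eq_left t.2.2, min_eq_left s.2.2] at hgap
    have : 0 < m * (((t : ℝ≥0) : ℝ) - (s : ℝ≥0)) := mul_pos hm0 (sub_pos.2 (NNReal.coe_lt_coe.2 hst))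
    linarith
  have hinj : Function.Injective g := by
    intro s t hst
    have hv : confClock x₀ W f U s ω = confClock x₀ W f U t ω := congrArg Subtype.val hst
    by_contra hne
    rcases lt_or_gt_of_ne (fun h : (s : ℝ≥0) = t ↦ hne (Subtype.ext h)) with h | h
    · exact absurd hv (ne_of_lt (hstrict s t h))
    · exact absurd hv (ne_of_gt (hstrict t s h))
  have hsurj : Function.Surjective g := by
    intro v
    have hivt := intermediate_value_Icc (show (0 : ℝ≥0) ≤ T from bot_le) (hcont.continuousOn (s := Icc 0 T))
    rw [confClock_zero] at hivt
    obtain ⟨t, ht, htv⟩ := hivt v.2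
    exact ⟨⟨t, ht⟩, Subtype.ext htv⟩
  set eq : Icc (0 : ℝ≥0) T ≃ Icc (0 : ℝ) (confClock x₀ W f U T ω) := Equiv.ofBijective g ⟨hinj, hsurj⟩ with heq
  haveI : CompactSpace (Icc (0 : ℝ≥0) T) := isCompact_iff_compactSpace.1 isCompact_Icc
  have hec : Continuous eq := hgc
  exact ⟨hec.homeoOfEquivCompactToT2, fun t ↦ rfl⟩

/-- **The inverse clock is continuous in the level** (finite exit time, strictly increasing
clock): `α_u = e⁻¹(u ∧ S)` for the clock homeomorphism `e : [0, T] → [0, S]`. [cite: Legall2016, proof of Thm. 5.13] -/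
theorem continuous_clockInvFun (hW : IsBrownianVec W P) (hD : IsOpen D) (hf : DifferentiableOn ℂ f D)
    (hU : IsOpen U) (hUD : closure U ⊆ toC ⁻¹' D) (hx₀ : x₀ ∈ U) {m : ℝ} (hm0 : 0 < m)
    (hm : ∀ y ∈ closure U, m ≤ ‖deriv f (toC y)‖ ^ 2) (hρ : hitTime x₀ W Uᶜ ω = T) :
    Continuous (clockInvFun x₀ W f U ω) := by
  obtain ⟨e, he⟩ := hW.exists_homeomorph_clock hD hf hU hUD hx₀ hm0 hm hρ
  have hS0 : 0 ≤ confClock x₀ W f U T ω := by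
    have := hW.confClock_mono hD hf hU hUD hx₀ ω (show (0 : ℝ≥0) ≤ T from bot_le); rwa [confClock_zero] at this
  -- the level capped at `S`, as a point of `[0, S]`
  set cap : ℝ≥0 → Icc (0 : ℝ) (confClock x₀ W f U T ω) := fun u ↦
    ⟨min (u : ℝ) (confClock x₀ W f U T ω), le_min u.coe_nonneg hS0, min_le_right _ _⟩ with hcap
  have hcapc : Continuous cap := ((NNReal.continuous_coe.min continuous_const)).subtype_mk _
  have hformula : clockInvFun x₀ W f U ω = fun u ↦ ((e.symm (cap u) : Icc (0 : ℝ≥0) T) : ℝ≥0) := by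
    funext u
    -- both sides are times `≤ T` with clock value `u ∧ S`
    set a : ℝ≥0 := clockInvFun x₀ W f U ω u with ha
    have haT : a ≤ T := untopA_clockInv_le hρ u
    have hval : confClock x₀ W f U a ω = min (u : ℝ) (confClock x₀ W f U T ω) :=
      hW.confClock_clockInv hD hf hU hUD hx₀ hρ u
    have hb := he (e.symm (cap u))
    rw [Homeomorph.apply_symm_apply] at hb
    -- `hb : min u S = σ_b`
    set b : ℝ≥0 := ((e.symm (cap u) : Icc (0 : ℝ≥0) T) : ℝ≥0) with hbdef
    have hbT : b ≤ T := (e.symm (cap u)).2.2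
    have hvb : confClock x₀ W f U b ω = min (u : ℝ) (confClock x₀ W f U T ω) := hb.symm
    show a = b
    by_contra hne
    rcases lt_or_gt_of_ne hne with h | h
    · have hgap := hW.confClock_sub_ge hD hf hU hUD hx₀ hm ω h.le
      rw [stopT_of_eq_coe hρ, stopT_of_eq_coe hρ, min_eq_left hbT, min_eq_left haT, hval, hvb, sub_self] at hgap
      have : 0 < m * ((b : ℝ) - a) := mul_pos hm0 (sub_pos.2 (NNReal.coe_lt_coe.2 h))
      linarith
    · have hgap := hW.confClock_sub_ge hD hf hU hUD hx₀ hm ω h.le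
      rw [stopT_of_eq_coe hρ, stopT_of_eq_coe hρ, min_eq_left hbT, min_eq_left haT, hval, hvb, sub_self] at hgap
      have : 0 < m * ((a : ℝ) - b) := mul_pos hm0 (sub_pos.2 (NNReal.coe_lt_coe.2 h))
      linarith
  rw [hformula]
  exact continuous_subtype_val.comp (e.symm.continuous.comp hcapc)

end Finite

end IsBrownianVec

end Literature.Probability.Process

end
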